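import Mathlib
import HarnessLib

/-!
# The zero-counting weight above the fold: `∫_X^∞ ln(γ/2π) dγ/γ² = (ln(X/2π) + 1)/X`

Helper file (`--supports stmt-RiemannHypothesis-0098`), elementary real analysis, no definitions.  Seat rh-explicit-weil-5
gen15 (file of record `HOME/rh-explicit-weil-5/WEIL5-KAPPA.md` §3).

Context (documentation only).  The Weil energy of the transported prolate seed is carried by the zeros above the fold
caustic `γ* = c + √(c² − χ_n) ≈ 2c = 4πμ` (`μ = e^{2a}`), each with weight `≈ plateau/γ²`; against the Riemann–von Mangoldt
density `(1/2π) ln(γ/2π) dγ` this gives the factor `∫_{γ*}^∞ ln(γ/2π) dγ/γ² = (ln(γ*/2π) + 1)/γ*`, and at `γ* = 4πμ` the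
numerator is `ln(2μ) + 1 = 2a + 1 + ln 2` — the origin of the «(2a+1)» in the measured one-constant law
`λ₀ ≈ κ(2a+1)c(1 − λ_n)/χ_n` of WEIL5-CLASS §2(f).  This file proves the calculus identity and that evaluation.

* `hasDerivAt_logWeight`      : `d/dγ [−(ln(γ/2π) + 1)/γ] = ln(γ/2π)/γ²` (`γ > 0`);
* `integral_Ioi_log_div_sq`   : `∫_{(X,∞)} ln(γ/2π)/γ² dγ = (ln(X/2π) + 1)/X` for `X ≥ 2π`;
* `integral_Ioi_log_div_sq_fold` : at `X = 4π e^{2a}` the value is `(2a + 1 + ln 2)/(4π e^{2a})`.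

Standard axioms only; no `sorry`.
-/

set_option linter.dupNamespace false
set_option autoImplicit false

noncomputable section

open Real MeasureTheory Set Filter Topology

namespace Summit.RiemannHypothesis.RiemannHypothesis.Theorems.WeilZeroCountWeight

/-- The antiderivative: `d/dγ [−(ln(γ/2π) + 1)/γ] = ln(γ/2π)/γ²` for `γ > 0`. -/
theorem hasDerivAt_logWeight {γ : ℝ} (hγ : 0 < γ) :
    HasDerivAt (fun x : ℝ => -(Real.log (x / (2 * π)) + 1) / x) (Real.log (γ / (2 * π)) / γ ^ 2) γ := by
  have h2pi : (0 : ℝ) < 2 * π := by positivity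
  have hlog : HasDerivAt (fun x : ℝ => Real.log (x / (2 * π))) (1 / γ) γ := by
    have h := ((hasDerivAt_id' γ).div_const (2 * π)).log (div_pos hγ h2pi).ne'
    refine h.congr_deriv ?_
    field_simp
  have hnum : HasDerivAt (fun x : ℝ => -(Real.log (x / (2 * π)) + 1)) (-(1 / γ)) γ :=
    (hlog.add_const 1).neg
  have h := hnum.div (hasDerivAt_id' γ) hγ.ne'
  refine h.congr_deriv ?_
  field_simp
  ring

/-- **The zero-counting weight above `X`.**  For `X ≥ 2π`: `∫_{(X,∞)} ln(γ/2π)/γ² dγ = (ln(X/2π) + 1)/X`. -/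
theorem integral_Ioi_log_div_sq {X : ℝ} (hX : 2 * π ≤ X) :
    ∫ γ in Ioi X, Real.log (γ / (2 * π)) / γ ^ 2 = (Real.log (X / (2 * π)) + 1) / X := by
  have h2pi : (0 : ℝ) < 2 * π := by positivity
  have hX0 : 0 < X := lt_of_lt_of_le h2pi hX
  -- the limit of the antiderivative at infinity is 0
  have hlim : Tendsto (fun x : ℝ => -(Real.log (x / (2 * π)) + 1) / x) atTop (𝓝 0) := by
    have h1 : Tendsto (fun x : ℝ => Real.log x / x) atTop (𝓝 0) := by
      have := Real.tendsto_pow_log_div_mul_add_atTop 1 0 1 one_ne_zero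
      simpa using this
    have h2 : Tendsto (fun x : ℝ => (1 - Real.log (2 * π)) / x) atTop (𝓝 0) :=
      tendsto_const_nhds.div_atTop tendsto_id
    have h3 := (h1.add h2).neg
    simp only [add_zero, neg_zero] at h3
    refine h3.congr' ?_
    filter_upwards [eventually_gt_atTop (0 : ℝ)] with x hx
    rw [Real.log_div hx.ne' h2pi.ne']
    field_simp
    ring
  have hderiv : ∀ x ∈ Ioi X, HasDerivAt (fun x : ℝ => -(Real.log (x / (2 * π)) + 1) / x)
      (Real.log (x / (2 * π)) / x ^ 2) x :=
    fun x hx => hasDerivAt_logWeight (lt_trans hX0 hx)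
  have hnonneg : ∀ x ∈ Ioi X, 0 ≤ Real.log (x / (2 * π)) / x ^ 2 := by
    intro x hx
    have hx' : 2 * π ≤ x := le_trans hX (le_of_lt hx)
    exact div_nonneg (Real.log_nonneg ((one_le_div h2pi).mpr hx')) (sq_nonneg x)
  have hcont : ContinuousWithinAt (fun x : ℝ => -(Real.log (x / (2 * π)) + 1) / x) (Ici X) X :=
    (hasDerivAt_logWeight hX0).continuousAt.continuousWithinAt
  have hint : IntegrableOn (fun x : ℝ => Real.log (x / (2 * π)) / x ^ 2) (Ioi X) :=
    integrableOn_Ioi_deriv_of_nonneg hcont hderiv hnonneg hlim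
  rw [integral_Ioi_of_hasDerivAt_of_tendsto hcont hderiv hint hlim]
  field_simp
  ring

/-- **At the fold.**  With `μ = e^{2a}` and `X = 4πμ` (`≈ γ*`, twice the bandwidth `c = 2πμ`):
`∫_{(4πμ,∞)} ln(γ/2π)/γ² dγ = (2a + 1 + ln 2)/(4π e^{2a})` — the «(2a + 1)» of the energy law, plus `ln 2`. -/
theorem integral_Ioi_log_div_sq_fold (a : ℝ) (ha : 0 ≤ a) :
    ∫ γ in Ioi (4 * π * Real.exp (2 * a)), Real.log (γ / (2 * π)) / γ ^ 2 =
      (2 * a + 1 + Real.log 2) / (4 * π * Real.exp (2 * a)) := by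
  have h2pi : (0 : ℝ) < 2 * π := by positivity
  have hexp : 1 ≤ Real.exp (2 * a) := Real.one_le_exp (by linarith)
  have hX : 2 * π ≤ 4 * π * Real.exp (2 * a) := by nlinarith [pi_pos]
  rw [integral_Ioi_log_div_sq hX]
  have : 4 * π * Real.exp (2 * a) / (2 * π) = 2 * Real.exp (2 * a) := by
    field_simp
    ring
  rw [this, Real.log_mul two_ne_zero (Real.exp_pos _).ne', Real.log_exp]
  ring

end Summit.RiemannHypothesis.RiemannHypothesis.Theorems.WeilZeroCountWeight

end
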